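import Summits.BirchSwinnertonDyer.BirchSwinnertonDyer.Theorems.CyclotomicUntwistGNineFrobeniusTraceBridge
import Summits.BirchSwinnertonDyer.BirchSwinnertonDyer.Theorems.CyclotomicUntwistGNineSpecialFibre
import Summits.BirchSwinnertonDyer.BirchSwinnertonDyer.Theorems.CyclotomicUntwistGNineSpecialFibreTrace
import Literature.NumberTheory.Automorphic.SolvableBaseChangeModularityProofs
import HarnessLib

/-!
# LAW L-a3 (N) over `ℚ(ζ₉)`, leaf level: the trace of Frobenius of the two principal-series leaf
# families at a place `w ∣ 3` with residue field `𝔽₃` IS `−3·valMinAbs γ̄₁` (leaf II) / `+3·valMinAbs γ̄₁`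
# (leaf IV) = the closed form `psUntwistedTrace` (route `CyclotomicUntwist`, cruxes K1 / K2)

Cell `pub/bsd-wall` (D-0145 line `route-BirchSwinnertonDyer-CyclotomicUntwist`), seat `bsd-line-cycu-p3`
(gen 7). Helper toward K1 `PSRankOneLowerHalfAtThree` (stmt-BirchSwinnertonDyer-21580) / K2 (21581).
THEOREMS ONLY (no definition, no named fact, no `sorry`); BSD is not proved by this file and no crux is.

Setting: a number field `F` with a primitive ninth root of unity `ζ`, a place `w ∋ 3` WITH RESIDUE FIELD
OF ORDER `3` (`#(𝓞 F ⧸ w) = 3`; automatic for `F = ℚ(ζ₉)`, see the W-level file), and the two leaf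
families of cycu-p1's (G₉) recipes (`GNine.hasGoodReductionAt_leafII`, `…_leafIV`):

* leaf II `X = y² = x³ + 3(3α₁ − g)x² + 9βx + 3(3γ₁ + g)` (`g = ±1`, `v₃Δ = 4`);
* leaf IV `X = y² = x³ + 9αx² + 9(3β₁ − 1)x + 9(3γ₁ + g)` (`g = ±1`, `v₃Δ = 6`).

What is proved (the step «special fibre ⟹ `frobeniusTraceAt`» that `LAW-La3-KERNEL-v4.md` §3 lists as
NOT KERNEL):

* `leafII_goodModel_valuation_Δ`, `leafIV_goodModel_valuation_Δ` — the good models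
  `(ϖ², gϖ²(1+ϖ), 0, 0) • X` resp. `(ϖ³, −gϖ⁴ζ, 0, 0) • X` (`ϖ = 1 − ζ`) have `w`-UNIT discriminant
  (`Δ' = Δᵘ/θ⁴` resp. `Δᵘ/θ⁶` with `ϖ⁶ = −3θ`, `3 ∤ Δᵘ`);
* **`frobeniusTraceAt_leafII`**: `a_w(X) = −3·valMinAbs γ̄₁`; **`frobeniusTraceAt_leafIV`**: `a_w(X) = 3·valMinAbs γ̄₁`
  (bridge `GNineFrobeniusTrace.frobeniusTraceAt_eq_of_specialFibre` on the good model, whose special fibre is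
  `y² = x³ − x ± γ̄₁` by `GNineSpecialFibre.leafII_special_fibre` / `leafIV_special_fibre` (p610052), transported
  to `X` by `frobeniusTraceAt_smul` (Silverman VII.1.3(b)));
* **`frobeniusTraceAt_leafII_eq_psUntwistedTrace`**, **`…_leafIV_…`**: `a_w(X ⊗ F) = psUntwistedTrace (X/ℚ)` —
  the closed form (N′) of `CyclotomicUntwistPSUntwistedTraceDefs` IS the Frobenius trace, by name, on both leaf
  families (composition with p618242 `PSUntwistedTrace.psUntwistedTrace_leafII/IV`);
* `natCard_point_reductionAt_leafII/IV` — `#X̃_w(k_w) = 4 + 3·valMinAbs γ̄₁` resp. `4 − 3·valMinAbs γ̄₁`.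

References: J. Tate, LNM 476 (1975) §7 [Tate1975]; A. Kraus, Manuscripta Math. 69 (1990), Théorème (p = 3)
[Kraus1990]; J. H. Silverman, *AEC* VII.1 Prop. 1.3(b), VII.5.1(a), C.§16 [SilvermanAEC2009].
-/

-- single-conjunct summit: `Summit.BirchSwinnertonDyer.BirchSwinnertonDyer.…` repeats the name by design
set_option linter.dupNamespace false
set_option autoImplicit false

noncomputable section

open scoped NumberField Classical

open IsDedekindDomain IsDedekindDomain.HeightOneSpectrum NumberField WeierstrassCurve
  Literature.NumberTheory.EllipticCurves
  Summit.BirchSwinnertonDyer.BirchSwinnertonDyer.Theorems.GNine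

namespace Summit.BirchSwinnertonDyer.BirchSwinnertonDyer.Theorems.GNineFrobeniusTrace

variable {F : Type} [Field F] [NumberField F] {ζ : F} (w : HeightOneSpectrum (𝓞 F))

/-! ### Small tools -/

omit [NumberField F] in
/-- A cubic model over `F` with integer coefficients is the base change of the integer model. [folklore] -/
theorem cubic_intCast_eq_map (A₂ A₄ A₆ : ℤ) :
    (⟨0, (A₂ : F), 0, (A₄ : F), (A₆ : F)⟩ : WeierstrassCurve F) =
      (⟨0, A₂, 0, A₄, A₆⟩ : WeierstrassCurve ℤ).map (Int.castRingHom F) := by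
  rw [cubic_map]; simp

omit [NumberField F] in
/-- The discriminant of an integer cubic model read in `F`. [folklore] -/
theorem cubic_intCast_Δ (A₂ A₄ A₆ : ℤ) :
    (⟨0, (A₂ : F), 0, (A₄ : F), (A₆ : F)⟩ : WeierstrassCurve F).Δ =
      (((⟨0, A₂, 0, A₄, A₆⟩ : WeierstrassCurve ℤ).Δ : ℤ) : F) := by
  rw [cubic_intCast_eq_map, map_Δ]; simp

/-- An integer cubic model with non-zero discriminant is elliptic over `F`. [folklore] -/
theorem isElliptic_cubic_intCast {A₂ A₄ A₆ : ℤ} (h : (⟨0, A₂, 0, A₄, A₆⟩ : WeierstrassCurve ℤ).Δ ≠ 0) :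
    (⟨0, (A₂ : F), 0, (A₄ : F), (A₆ : F)⟩ : WeierstrassCurve F).IsElliptic :=
  ⟨by rw [cubic_intCast_Δ, isUnit_iff_ne_zero]; exact_mod_cast h⟩

/-- `ϖ⁶ = −3θ` gives `(ϖᵏ)⁻¹² · 3^{2k} · D = D / θ^{2k}`-type identities: `k = 2`. [folklore] -/
theorem inv_pow_mul_eq_of_pow_six {ϖ θ : F} (hθ : θ ≠ 0) (h6 : ϖ ^ 6 = -3 * θ) (D : F) :
    (ϖ ^ 2)⁻¹ ^ 12 * ((3 : F) ^ 4 * D) = D * (θ ^ 4)⁻¹ := by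
  have h24 : (ϖ ^ 2) ^ 12 = 81 * θ ^ 4 := by
    calc (ϖ ^ 2) ^ 12 = (ϖ ^ 6) ^ 4 := by ring
      _ = 81 * θ ^ 4 := by rw [h6]; ring
  have hθ4 : θ ^ 4 ≠ 0 := pow_ne_zero _ hθ
  rw [inv_pow, h24]
  field_simp
  ring

/-- The same for `k = 3`: `(ϖ³)⁻¹² · 3⁶ · D = D / θ⁶`. [folklore] -/
theorem inv_pow_mul_eq_of_pow_six' {ϖ θ : F} (hθ : θ ≠ 0) (h6 : ϖ ^ 6 = -3 * θ) (D : F) :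
    (ϖ ^ 3)⁻¹ ^ 12 * ((3 : F) ^ 6 * D) = D * (θ ^ 6)⁻¹ := by
  have h36 : (ϖ ^ 3) ^ 12 = 729 * θ ^ 6 := by
    calc (ϖ ^ 3) ^ 12 = (ϖ ^ 6) ^ 6 := by ring
      _ = 729 * θ ^ 6 := by rw [h6]; ring
  have hθ6 : θ ^ 6 ≠ 0 := pow_ne_zero _ hθ
  rw [inv_pow, h36]
  field_simp
  ring

/-! ### Leaf II -/

section LeafII

variable (α₁ β γ₁ g : ℤ)

/-- `3 ∤ Δᵘ` on leaf II (`Δᵘ ≡ 7 + 3gγ₁ (mod 9)`, `leafII_Δu_emod_nine`). [cite: Kraus1990, Théorème (p = 3)] -/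
theorem leafII_not_three_dvd_Δu {g : ℤ} (hg : g ^ 2 = 1) :
    ¬ (3 : ℤ) ∣ (64 * g ^ 4 + 192 * γ₁ * g ^ 3 + 144 * β ^ 2 * g ^ 2 - 576 * α₁ * g ^ 3 - 1728 * α₁ * γ₁ * g ^ 2
        - 864 * α₁ * β ^ 2 * g + 1728 * α₁ ^ 2 * g ^ 2 + 5184 * α₁ ^ 2 * γ₁ * g + 1296 * α₁ ^ 2 * β ^ 2
        - 1728 * α₁ ^ 3 * g - 5184 * α₁ ^ 3 * γ₁ - 288 * β * g ^ 2 - 864 * β * γ₁ * g - 576 * β ^ 3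
        + 864 * α₁ * β * g + 2592 * α₁ * β * γ₁ - 48 * g ^ 2 - 288 * γ₁ * g - 432 * γ₁ ^ 2) := by
  have h := PSUntwistedTrace.leafII_Δu_emod_nine α₁ β γ₁ hg
  generalize (64 * g ^ 4 + 192 * γ₁ * g ^ 3 + 144 * β ^ 2 * g ^ 2 - 576 * α₁ * g ^ 3 - 1728 * α₁ * γ₁ * g ^ 2
        - 864 * α₁ * β ^ 2 * g + 1728 * α₁ ^ 2 * g ^ 2 + 5184 * α₁ ^ 2 * γ₁ * g + 1296 * α₁ ^ 2 * β ^ 2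
        - 1728 * α₁ ^ 3 * g - 5184 * α₁ ^ 3 * γ₁ - 288 * β * g ^ 2 - 864 * β * γ₁ * g - 576 * β ^ 3
        + 864 * α₁ * β * g + 2592 * α₁ * β * γ₁ - 48 * g ^ 2 - 288 * γ₁ * g - 432 * γ₁ ^ 2) = x at h ⊢
  rw [show (7 + 3 * g * γ₁) = 7 + 3 * (g * γ₁) by ring] at h
  generalize g * γ₁ = y at h
  omega

/-- The leaf-II integer model has non-zero discriminant `3⁴·Δᵘ`. [cite: Kraus1990, Théorème (p = 3)] -/
theorem leafII_int_Δ_ne_zero {g : ℤ} (hg : g ^ 2 = 1) :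
    (⟨0, 3 * (3 * α₁ - g), 0, 9 * β, 3 * (3 * γ₁ + g)⟩ : WeierstrassCurve ℤ).Δ ≠ 0 := by
  rw [PSUntwistedTrace.leafII_Δ_eq]
  have h := leafII_not_three_dvd_Δu α₁ β γ₁ hg
  intro h0
  rcases mul_eq_zero.mp h0 with h1 | h1
  · norm_num at h1
  · exact h ⟨0, by rw [h1]; ring⟩

/-- **Leaf II, the good model has `w`-unit discriminant**: `w((ϖ²)⁻¹² · Δ) = 1` (`Δ = 3⁴Δᵘ`, `ϖ⁶ = −3θ`,
`3 ∤ Δᵘ`, `θ` a `w`-unit). [cite: Kraus1990, Théorème (p = 3)] [cite: SilvermanAEC2009, VII.5 Prop. 5.1(a)] -/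
theorem leafII_goodModel_valuation_Δ (hζ : IsPrimitiveRoot ζ 9) (hw : (3 : 𝓞 F) ∈ w.asIdeal)
    {g : ℤ} (hg : g ^ 2 = 1) :
    w.valuation F ((((1 : F) - ζ) ^ 2)⁻¹ ^ 12 *
      (⟨0, ((3 * (3 * α₁ - g) : ℤ) : F), 0, ((9 * β : ℤ) : F), ((3 * (3 * γ₁ + g) : ℤ) : F)⟩ :
        WeierstrassCurve F).Δ) = 1 := by
  have h6 := varpi_pow_six hζ
  have hθ1 := val_theta_eq_one w hw hζ
  have hθ0 := theta_ne_zero w hw hζ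
  rw [cubic_intCast_Δ, PSUntwistedTrace.leafII_Δ_eq, Int.cast_mul, Int.cast_pow,
    show ((3 : ℤ) : F) = 3 by norm_num, inv_pow_mul_eq_of_pow_six hθ0 h6, map_mul, map_inv₀, map_pow,
    hθ1, one_pow, inv_one, mul_one]
  exact val_intCast_eq_one_of_not_dvd w hw (leafII_not_three_dvd_Δu α₁ β γ₁ hg)

/-- **Leaf II: `a_w = −3·valMinAbs γ̄₁`.** For `F ∋ ζ₉`, `w ∋ 3` with `#k_w = 3`, and the leaf-II cubic
`X = y² = x³ + 3(3α₁ − g)x² + 9βx + 3(3γ₁ + g)` (`g = ±1`): `a_w(X) = −3·valMinAbs γ̄₁` — the good model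
`(ϖ², gϖ²(1+ϖ), 0, 0) • X` reduces to `y² = x³ − x + γ̄₁` (p610052) and `a_w` is an `F`-isomorphism invariant
(Silverman VII.1.3(b)). [cite: Kraus1990, Théorème (p = 3)] [cite: SilvermanAEC2009, VII.1 Prop. 1.3(b) and C.§16] -/
theorem frobeniusTraceAt_leafII (hζ : IsPrimitiveRoot ζ 9) (hw : (3 : 𝓞 F) ∈ w.asIdeal)
    (hq : Nat.card (𝓞 F ⧸ w.asIdeal) = 3) {g : ℤ} (hg : g ^ 2 = 1) :
    (⟨0, ((3 * (3 * α₁ - g) : ℤ) : F), 0, ((9 * β : ℤ) : F), ((3 * (3 * γ₁ + g) : ℤ) : F)⟩ :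
      WeierstrassCurve F).frobeniusTraceAt w = -3 * ZMod.valMinAbs (γ₁ : ZMod 3) := by
  set A₂ : F := ((3 * (3 * α₁ - g) : ℤ) : F) with hA₂
  set A₄ : F := ((9 * β : ℤ) : F) with hA₄
  set A₆ : F := ((3 * (3 * γ₁ + g) : ℤ) : F) with hA₆
  set X : WeierstrassCurve F := ⟨0, A₂, 0, A₄, A₆⟩ with hX
  have hϖ0 : (1 : F) - ζ ≠ 0 := one_sub_zeta_ne_zero hζ
  have hu : ((1 : F) - ζ) ^ 2 ≠ 0 := pow_ne_zero _ hϖ0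
  set u : F := ((1 : F) - ζ) ^ 2 with hudef
  set r : F := (g : F) * ((1 : F) - ζ) ^ 2 * (1 + ((1 : F) - ζ)) with hrdef
  -- the good model
  set X' : WeierstrassCurve F := ⟨0, u⁻¹ ^ 2 * (A₂ + 3 * r), 0, u⁻¹ ^ 4 * (A₄ + 2 * r * A₂ + 3 * r ^ 2),
    u⁻¹ ^ 6 * (A₆ + r * A₄ + r ^ 2 * A₂ + r ^ 3)⟩ with hX'
  have hsmul : (⟨Units.mk0 u hu, r, 0, 0⟩ : VariableChange F) • X = X' := chg_smul_cubic u hu r A₂ A₄ A₆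
  obtain ⟨h₂, h₄, h₆⟩ := GNineSpecialFibre.leafII_special_fibre w hζ hw α₁ β γ₁ g hg
  have h₁ : w.valuation F X'.a₁ < 1 := by rw [hX']; simp
  have h₃ : w.valuation F X'.a₃ < 1 := by rw [hX']; simp
  have h₂' : w.valuation F X'.a₂ < 1 := h₂
  have h₄' : w.valuation F (X'.a₄ + 1) < 1 := by rw [← sub_neg_eq_add]; exact h₄
  have h₆' : w.valuation F (X'.a₆ - (γ₁ : ℤ)) < 1 := h₆
  have hΔ' : w.valuation F X'.Δ = 1 := by
    rw [hX', chg_smul_cubic_Δ u hu]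
    exact leafII_goodModel_valuation_Δ w α₁ β γ₁ hζ hw hg
  have htr : X'.frobeniusTraceAt w = -3 * ZMod.valMinAbs (γ₁ : ZMod 3) :=
    frobeniusTraceAt_eq_of_specialFibre X' w γ₁ h₁ h₂' h₃ h₄' h₆' hΔ' hq
  -- transport along the change of variables
  haveI : X.IsElliptic := isElliptic_cubic_intCast (leafII_int_Δ_ne_zero α₁ β γ₁ hg)
  have hgood : X.HasGoodReductionAt w := hasGoodReductionAt_leafII w hζ hw α₁ β γ₁ g hg
  rw [← WeierstrassCurve.frobeniusTraceAt_smul X ⟨Units.mk0 u hu, r, 0, 0⟩ w hgood, hsmul, htr]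

/-- **Leaf II: (N′) IS the Frobenius trace.** `a_w(X ⊗ F) = psUntwistedTrace (X/ℚ)` for the leaf-II model
(composition with p618242 `psUntwistedTrace_leafII`). [cite: Kraus1990, Théorème (p = 3)] [cite: SilvermanAEC2009, C.§16] -/
theorem frobeniusTraceAt_leafII_eq_psUntwistedTrace (hζ : IsPrimitiveRoot ζ 9) (hw : (3 : 𝓞 F) ∈ w.asIdeal)
    (hq : Nat.card (𝓞 F ⧸ w.asIdeal) = 3) {g : ℤ} (hg : g ^ 2 = 1) :
    (⟨0, ((3 * (3 * α₁ - g) : ℤ) : F), 0, ((9 * β : ℤ) : F), ((3 * (3 * γ₁ + g) : ℤ) : F)⟩ :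
      WeierstrassCurve F).frobeniusTraceAt w =
      ((⟨0, 3 * (3 * α₁ - g), 0, 9 * β, 3 * (3 * γ₁ + g)⟩ : WeierstrassCurve ℤ).map
        (Int.castRingHom ℚ)).psUntwistedTrace := by
  rw [frobeniusTraceAt_leafII w α₁ β γ₁ hζ hw hq hg, PSUntwistedTrace.psUntwistedTrace_leafII α₁ β γ₁ hg]

/-- **Leaf II: `#X̃_w(k_w) = 4 + 3·valMinAbs γ̄₁`** (`= #{y² = x³ − x + γ̄₁}(𝔽₃) ∈ {1, 4, 7}`).
[cite: SilvermanAEC2009, C.§16 and V.2] -/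
theorem natCard_point_reductionAt_leafII (hζ : IsPrimitiveRoot ζ 9) (hw : (3 : 𝓞 F) ∈ w.asIdeal)
    (hq : Nat.card (𝓞 F ⧸ w.asIdeal) = 3) {g : ℤ} (hg : g ^ 2 = 1) :
    (Nat.card ((⟨0, ((3 * (3 * α₁ - g) : ℤ) : F), 0, ((9 * β : ℤ) : F), ((3 * (3 * γ₁ + g) : ℤ) : F)⟩ :
      WeierstrassCurve F).reductionAt w).toAffine.Point : ℤ) = 4 + 3 * ZMod.valMinAbs (γ₁ : ZMod 3) := by
  have h := frobeniusTraceAt_leafII w α₁ β γ₁ hζ hw hq hg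
  rw [frobeniusTraceAt_def, IsDedekindDomain.HeightOneSpectrum.natCard_residueField_adicCompletionIntegers F w,
    hq] at h
  simp only [Nat.cast_ofNat] at h
  linarith

end LeafII

/-! ### Leaf IV -/

section LeafIV

variable (α β₁ γ₁ g : ℤ)

/-- The leaf-IV integer model has non-zero discriminant `3⁶·Δᵘ`. [cite: Kraus1990, Théorème (p = 3)] -/
theorem leafIV_int_Δ_ne_zero {g : ℤ} (hg : g ^ 2 = 1) :
    (⟨0, 9 * α, 0, 9 * (3 * β₁ - 1), 9 * (3 * γ₁ + g)⟩ : WeierstrassCurve ℤ).Δ ≠ 0 := by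
  rw [PSUntwistedTrace.leafIV_Δ_eq]
  have h := PSUntwistedTrace.leafIV_not_three_dvd_Δu α β₁ γ₁ hg
  intro h0
  rcases mul_eq_zero.mp h0 with h1 | h1
  · norm_num at h1
  · exact h ⟨0, by rw [h1]; ring⟩

/-- **Leaf IV, the good model has `w`-unit discriminant**: `w((ϖ³)⁻¹² · Δ) = 1` (`Δ = 3⁶Δᵘ`, `ϖ⁶ = −3θ`,
`3 ∤ Δᵘ`). [cite: Kraus1990, Théorème (p = 3)] [cite: SilvermanAEC2009, VII.5 Prop. 5.1(a)] -/
theorem leafIV_goodModel_valuation_Δ (hζ : IsPrimitiveRoot ζ 9) (hw : (3 : 𝓞 F) ∈ w.asIdeal)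
    {g : ℤ} (hg : g ^ 2 = 1) :
    w.valuation F ((((1 : F) - ζ) ^ 3)⁻¹ ^ 12 *
      (⟨0, ((9 * α : ℤ) : F), 0, ((9 * (3 * β₁ - 1) : ℤ) : F), ((9 * (3 * γ₁ + g) : ℤ) : F)⟩ :
        WeierstrassCurve F).Δ) = 1 := by
  have h6 := varpi_pow_six hζ
  have hθ1 := val_theta_eq_one w hw hζ
  have hθ0 := theta_ne_zero w hw hζ
  rw [cubic_intCast_Δ, PSUntwistedTrace.leafIV_Δ_eq, Int.cast_mul, Int.cast_pow,
    show ((3 : ℤ) : F) = 3 by norm_num, inv_pow_mul_eq_of_pow_six' hθ0 h6, map_mul, map_inv₀, map_pow,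
    hθ1, one_pow, inv_one, mul_one]
  exact val_intCast_eq_one_of_not_dvd w hw (PSUntwistedTrace.leafIV_not_three_dvd_Δu α β₁ γ₁ hg)

/-- **Leaf IV: `a_w = 3·valMinAbs γ̄₁`.** For `F ∋ ζ₉`, `w ∋ 3` with `#k_w = 3`, and the leaf-IV cubic
`X = y² = x³ + 9αx² + 9(3β₁ − 1)x + 9(3γ₁ + g)` (`g = ±1`): `a_w(X) = 3·valMinAbs γ̄₁` — the good model
`(ϖ³, −gϖ⁴ζ, 0, 0) • X` reduces to `y² = x³ − x − γ̄₁` (p610052). [cite: Kraus1990, Théorème (p = 3)]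
[cite: SilvermanAEC2009, VII.1 Prop. 1.3(b) and C.§16] -/
theorem frobeniusTraceAt_leafIV (hζ : IsPrimitiveRoot ζ 9) (hw : (3 : 𝓞 F) ∈ w.asIdeal)
    (hq : Nat.card (𝓞 F ⧸ w.asIdeal) = 3) {g : ℤ} (hg : g ^ 2 = 1) :
    (⟨0, ((9 * α : ℤ) : F), 0, ((9 * (3 * β₁ - 1) : ℤ) : F), ((9 * (3 * γ₁ + g) : ℤ) : F)⟩ :
      WeierstrassCurve F).frobeniusTraceAt w = 3 * ZMod.valMinAbs (γ₁ : ZMod 3) := by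
  set A₂ : F := ((9 * α : ℤ) : F) with hA₂
  set A₄ : F := ((9 * (3 * β₁ - 1) : ℤ) : F) with hA₄
  set A₆ : F := ((9 * (3 * γ₁ + g) : ℤ) : F) with hA₆
  set X : WeierstrassCurve F := ⟨0, A₂, 0, A₄, A₆⟩ with hX
  have hϖ0 : (1 : F) - ζ ≠ 0 := one_sub_zeta_ne_zero hζ
  have hu : ((1 : F) - ζ) ^ 3 ≠ 0 := pow_ne_zero _ hϖ0
  set u : F := ((1 : F) - ζ) ^ 3 with hudef
  set r : F := -(g : F) * ((1 : F) - ζ) ^ 4 * (1 - ((1 : F) - ζ)) with hrdef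
  set X' : WeierstrassCurve F := ⟨0, u⁻¹ ^ 2 * (A₂ + 3 * r), 0, u⁻¹ ^ 4 * (A₄ + 2 * r * A₂ + 3 * r ^ 2),
    u⁻¹ ^ 6 * (A₆ + r * A₄ + r ^ 2 * A₂ + r ^ 3)⟩ with hX'
  have hsmul : (⟨Units.mk0 u hu, r, 0, 0⟩ : VariableChange F) • X = X' := chg_smul_cubic u hu r A₂ A₄ A₆
  obtain ⟨h₂, h₄, h₆⟩ := GNineSpecialFibre.leafIV_special_fibre w hζ hw α β₁ γ₁ g hg
  have h₁ : w.valuation F X'.a₁ < 1 := by rw [hX']; simp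
  have h₃ : w.valuation F X'.a₃ < 1 := by rw [hX']; simp
  have h₂' : w.valuation F X'.a₂ < 1 := h₂
  have h₄' : w.valuation F (X'.a₄ + 1) < 1 := by rw [← sub_neg_eq_add]; exact h₄
  have h₆' : w.valuation F (X'.a₆ - ((-γ₁ : ℤ) : F)) < 1 := by rw [Int.cast_neg]; exact h₆
  have hΔ' : w.valuation F X'.Δ = 1 := by
    rw [hX', chg_smul_cubic_Δ u hu]
    exact leafIV_goodModel_valuation_Δ w α β₁ γ₁ hζ hw hg
  have htr : X'.frobeniusTraceAt w = -3 * ZMod.valMinAbs ((-γ₁ : ℤ) : ZMod 3) :=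
    frobeniusTraceAt_eq_of_specialFibre X' w (-γ₁) h₁ h₂' h₃ h₄' h₆' hΔ' hq
  have hval : ZMod.valMinAbs ((-γ₁ : ℤ) : ZMod 3) = -ZMod.valMinAbs (γ₁ : ZMod 3) := by
    rw [Int.cast_neg]
    rcases GNineSpecialFibrePointCount.zmod_three_cases (γ₁ : ZMod 3) with h | h | h <;> rw [h] <;> decide
  rw [hval] at htr
  haveI : X.IsElliptic := isElliptic_cubic_intCast (leafIV_int_Δ_ne_zero α β₁ γ₁ hg)
  have hgood : X.HasGoodReductionAt w := hasGoodReductionAt_leafIV w hζ hw α β₁ γ₁ g hg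
  rw [← WeierstrassCurve.frobeniusTraceAt_smul X ⟨Units.mk0 u hu, r, 0, 0⟩ w hgood, hsmul, htr]
  ring

/-- **Leaf IV: (N′) IS the Frobenius trace.** `a_w(X ⊗ F) = psUntwistedTrace (X/ℚ)` for the leaf-IV model
(composition with p618242 `psUntwistedTrace_leafIV`). [cite: Kraus1990, Théorème (p = 3)] [cite: SilvermanAEC2009, C.§16] -/
theorem frobeniusTraceAt_leafIV_eq_psUntwistedTrace (hζ : IsPrimitiveRoot ζ 9) (hw : (3 : 𝓞 F) ∈ w.asIdeal)
    (hq : Nat.card (𝓞 F ⧸ w.asIdeal) = 3) {g : ℤ} (hg : g ^ 2 = 1) :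
    (⟨0, ((9 * α : ℤ) : F), 0, ((9 * (3 * β₁ - 1) : ℤ) : F), ((9 * (3 * γ₁ + g) : ℤ) : F)⟩ :
      WeierstrassCurve F).frobeniusTraceAt w =
      ((⟨0, 9 * α, 0, 9 * (3 * β₁ - 1), 9 * (3 * γ₁ + g)⟩ : WeierstrassCurve ℤ).map
        (Int.castRingHom ℚ)).psUntwistedTrace := by
  rw [frobeniusTraceAt_leafIV w α β₁ γ₁ hζ hw hq hg, PSUntwistedTrace.psUntwistedTrace_leafIV α β₁ γ₁ hg]

/-- **Leaf IV: `#X̃_w(k_w) = 4 − 3·valMinAbs γ̄₁`** (`= #{y² = x³ − x − γ̄₁}(𝔽₃) ∈ {1, 4, 7}`).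
[cite: SilvermanAEC2009, C.§16 and V.2] -/
theorem natCard_point_reductionAt_leafIV (hζ : IsPrimitiveRoot ζ 9) (hw : (3 : 𝓞 F) ∈ w.asIdeal)
    (hq : Nat.card (𝓞 F ⧸ w.asIdeal) = 3) {g : ℤ} (hg : g ^ 2 = 1) :
    (Nat.card ((⟨0, ((9 * α : ℤ) : F), 0, ((9 * (3 * β₁ - 1) : ℤ) : F), ((9 * (3 * γ₁ + g) : ℤ) : F)⟩ :
      WeierstrassCurve F).reductionAt w).toAffine.Point : ℤ) = 4 - 3 * ZMod.valMinAbs (γ₁ : ZMod 3) := by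
  have h := frobeniusTraceAt_leafIV w α β₁ γ₁ hζ hw hq hg
  rw [frobeniusTraceAt_def, IsDedekindDomain.HeightOneSpectrum.natCard_residueField_adicCompletionIntegers F w,
    hq] at h
  simp only [Nat.cast_ofNat] at h
  linarith

end LeafIV

end Summit.BirchSwinnertonDyer.BirchSwinnertonDyer.Theorems.GNineFrobeniusTrace

end
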